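import Literature.NumberTheory.Automorphic.SLTwoTreeQuadraticTorusShellIndexCountUnramified   -- ★ V-INDEX-unr (this seat): inert units, shape-free coset criterion, `[TK : TK(m)] = (q+1)q^{m−1}`
import Literature.NumberTheory.Automorphic.SLTwoTreeQuadraticTorusShellCount                -- ★ (W′1) V-b (A-p17 (g23)): the ramified two-orbit twin; parts I–V-a in its closure
import HarnessLib

/-!
# The non-split quadratic torus on the tree of `SL₂(F)`, V-ORBIT-unr: at an UNRAMIFIED (inert) torus every shell is ONE `TK`-orbit, so
# `#{x | d x = m} = [TK : TK(m)] = (q+1)q^{m−1}` (`m ≥ 1`), `= 1` (`m = 0`), and a unit `a + bτ` with `|b| = |ϖ|ⁿ` fixes the VERTEX-ball `{x | d x ≤ n}` of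
# `1 + (q+1)(qⁿ − 1)∕(q − 1)` vertices (Labesse–Langlands 1979 §2 p. 8 «`δ_m = (q+1)q^{m−1}` if `L` is unramified»; Serre, *Trees* II.1.1)

Topic `NumberTheory/Automorphic`; namespace `Literature.NumberTheory.Automorphic.HermitianLatticeTree` (ROAD W's).  KERNEL mathematics only: theorems, no definition, no
named fact, no instance, no notation, no `sorry`.  Cell `pub/hodgecm-mathlib` (D-0151), crux H413 = `stmt-HodgeConjecture-24833`; «S3-ram» seeding wave (LEAD F0P3a-plan (g12)
T11-41∕T11-62; owner F0P3a-p06 (g15)); seat A-p12 (g23), organ «(W′1)-V-unr» part 2∕2 = the UNRAMIFIED twin of ★ `SLTwoTreeQuadraticTorusShellCount` §15 (A-p17 (g23): «the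
unramified twin (one orbit, `δ_m = (q+1)q^{m−1}`) — NOT here») and of ★ `SLTwoTreeQuadraticTorusEisenstein` ∕ `…ShellBall` §19.  Consumer: STUB B₂ of the P-2-ram skeleton (α₂)
(`F0/P3a/A-p12/g23/…skeleton.v1…`, e1ffe9e98ebbee4a): at a tame-RAMIFIED CM place `w ∣ v` a type-(2) `γ_H` of EVEN discriminant depth `2N = 4n` has UNRAMIFIED eigen-ratio
field `L⁺_v(√ε)`; its descended `PGL₂(L⁺_v)`-element is a unit `a + bτ` of the inert order with `ord b = n`, and its fixed vertices ∕ edges in the tree of `SL₂(L⁺_v)` — the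
`K♯`- ∕ `K`-cosets it fixes (★ (W1c)(W2) dictionary) — are the vertex-ball below and its `#V − 1` edges.
HONEST LABEL: HC_CM is proved only modulo the cell's 2 remaining named inputs (hLiu418 24832, h413 24833) until rung 0 closes; nothing printed is asserted here — elementary
lattice and group bookkeeping over a discrete valuation ring with finite residue field.

THE MATHEMATICS (tokens of (W′1) I–V VERBATIM: `γτ = (0, v; 1, u)`, `r m = diag(1, ϖ^m)`, `v₀ = latt 1`, shell index `d` with its two properties `hd hd′` (★ III), `TK`,
`TK(m)`; INERT SHAPE `hu hv hanis` of ★ V-INDEX-unr: the norm form `c² + ceu − e²v` is anisotropic modulo `𝔭`).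
* §1 `exists_torusInt_glVertexAct_eq_of_inert`: EVERY torus element `t ∈ centralizer {γτ}` acts on the vertices like an INTEGRAL UNIT-NORM element `t₀ ∈ TK` — divide by
  `ϖ^{ord(det t)∕2}`; the order of `det t = N(t)` is EVEN (★ `valuation_inertNorm_ne_valuation`: the ramified branch «`π·t₀`» of ★ §15 `exists_torusInt_glVertexAct_eq_or`
  cannot occur) and the quotient is integral (★ `integral_of_valuation_inertNorm_le_one`).
* §2 `setOf_shellIndex_eq_eq_orbit_of_inert`: **`{x | d x = m} = TK · x_m`** (ONE orbit); `ncard_setOf_shellIndex_eq_relIndex_of_inert` (`= [TK : TK(m)]`, ★ V-a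
  `ncard_torusInt_orbit_eq_relIndex`); **`ncard_setOf_shellIndex_eq_of_inert`**: `#{x | d x = m} = if m = 0 then 1 else (q+1)·q^{m−1}` — LL's UNRAMIFIED `δ_m` (★ V-INDEX-unr).
* §3 `ncard_setOf_glVertexAct_torus_eq_self_sep_shellIndex_of_inert`: for a unit `γ = (a, bv; b, a+bu)` (`a b ∈ 𝒪`, `|det γ| = 1`, `|b| = |ϖ|ⁿ`) the fixed set is finite and
  `#{x | γ·x = x ∧ d x = i} = if i ≤ n then δ_i else 0` (the shell-sum coefficients of ★ B-p14 `FixedPointsShellValueLaw` in the inert case).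
* §4 THE VERTEX BALL: `setOf_glVertexAct_torus_eq_self_eq_setOf_shellIndex_le` (`Fix(γ) = {x | d x ≤ n}`, ★ IV), `ncard_setOf_shellIndex_le_succ_of_inert` (the recursion
  `#B(n+1) = #B(n) + (q+1)qⁿ`) and **`ncard_setOf_shellIndex_le_of_inert`**: `(q − 1)·#{x | d x ≤ n} + 2 = (q + 1)·qⁿ`, i.e. `#B(n) = 1 + (q+1)(qⁿ−1)∕(q−1)` — the ball of
  radius `n` about a VERTEX of the `(q+1)`-regular tree [Serre, Trees II.1.1]; hence **`ncard_setOf_glVertexAct_torus_eq_self_of_inert`**: `(q−1)·#Fix(γ) + 2 = (q+1)·qⁿ`.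

## References
* [LabesseLanglands1979] J.-P. Labesse, R. P. Langlands, *L-indistinguishability for SL(2)*, Canad. J. Math. 31 (1979), §2 p. 8 (`δ_m = (q+1)q^{m−1}` if `L` is unramified).
* [Serre1980Trees] J.-P. Serre, *Trees* (1980), Ch. II §1.1 (the tree of `SL₂` over a local field is `(q+1)`-regular; balls), §1.3 (stabilisers).
* [Kottwitz1988] R. E. Kottwitz, *Tamagawa numbers*, Ann. of Math. 127 (1988), §2 (fixed points of elliptic elements on the tree).
-/

set_option autoImplicit false

noncomputable section

open scoped ValuativeRel Matrix MatrixGroups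
open Matrix ValuativeRel

namespace Literature.NumberTheory.Automorphic.HermitianLatticeTree

open Literature.NumberTheory.Automorphic Literature.NumberTheory.LocalFields

variable {F : Type*} [Field F] [ValuativeRel F] {ϖ : F} (hϖ : IsUniformizingElement ϖ) [IsDiscreteValuationRing 𝒪[F]]

/-! ## §1 In the inert shape every torus element acts like an element of `TK` -/

include hϖ in
/-- **NORMALISING A TORUS ELEMENT, INERT SHAPE**: every `t ∈ centralizer {γτ}` acts on the vertices of the tree of `SL₂(F)` like an INTEGRAL UNIT-NORM torus element
`t₀ ∈ TK = centralizer {γτ} ⊓ GL₂(𝒪)` — divide by the scalar `ϖ^{ord(det t)∕2}` (scalars act trivially, ★ `glVertexAct_scalar_mul`); `ord(det t)` is EVEN because no element of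
the inert order has norm of valuation `|ϖ|` (★ `valuation_inertNorm_ne_valuation`), and the quotient is integral by ★ `integral_of_valuation_inertNorm_le_one`.  (The ramified
★ `exists_torusInt_glVertexAct_eq_or` has a second branch `π · t₀`; here it is void.) [cite: LabesseLanglands1979, §2 p. 8] [cite: Serre1980Trees, Ch. II §1.3] -/
theorem exists_torusInt_glVertexAct_eq_of_inert {u v : F} (hu : u ∈ 𝒪[F]) (hv : v ∈ 𝒪[F])
    (hanis : ∀ c e : F, c ∈ 𝒪[F] → e ∈ 𝒪[F] → valuation F (c ^ 2 + c * e * u - e ^ 2 * v) < 1 → valuation F c < 1 ∧ valuation F e < 1)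
    {γτ : GL (Fin 2) F} (hγτ : (γτ : Matrix (Fin 2) (Fin 2) F) = !![0, v; 1, u])
    {t : GL (Fin 2) F} (ht : t ∈ Subgroup.centralizer ({γτ} : Set (GL (Fin 2) F))) :
    ∃ t₀ ∈ Subgroup.centralizer ({γτ} : Set (GL (Fin 2) F)) ⊓ glInt 2 F, ∀ x, glVertexAct hϖ t x = glVertexAct hϖ t₀ x := by
  have h0 := hϖ.ne_zero
  have hv0 : valuation F ϖ ≠ 0 := (Valuation.ne_zero_iff _).2 h0
  have hE := integral_of_valuation_inertNorm_le_one hanis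
  -- membership in `TK` from the centraliser and a unit determinant, via `hE`; impossibility of `|det| = |ϖ|`
  have key : ∀ s : GL (Fin 2) F, s ∈ Subgroup.centralizer ({γτ} : Set (GL (Fin 2) F)) → valuation F (s : Matrix (Fin 2) (Fin 2) F).det = 1 →
      s ∈ Subgroup.centralizer ({γτ} : Set (GL (Fin 2) F)) ⊓ glInt 2 F := by
    intro s hs hsdet
    obtain ⟨c, e, hse⟩ := (mem_centralizer_companion_iff hγτ s).1 hs
    have hN : valuation F (c ^ 2 + c * e * u - e ^ 2 * v) ≤ 1 := by
      rw [← QuadraticRegularRep.det_regRep u v c e, ← hse, hsdet]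
    obtain ⟨hc, he⟩ := hE c e hN
    exact (mem_centralizer_inf_glInt_iff hu hv hγτ s).2 ⟨c, e, hc, he, hse, hsdet⟩
  have key' : ∀ s : GL (Fin 2) F, s ∈ Subgroup.centralizer ({γτ} : Set (GL (Fin 2) F)) → valuation F (s : Matrix (Fin 2) (Fin 2) F).det ≠ valuation F ϖ := by
    intro s hs hsdet
    obtain ⟨c, e, hse⟩ := (mem_centralizer_companion_iff hγτ s).1 hs
    have hN : valuation F (c ^ 2 + c * e * u - e ^ 2 * v) = valuation F ϖ := by
      rw [← QuadraticRegularRep.det_regRep u v c e, ← hse, hsdet]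
    obtain ⟨hc, he⟩ := hE c e (by rw [hN]; exact hϖ.valuation_le_one)
    exact valuation_inertNorm_ne_valuation hϖ hu hv hanis hc he hN
  -- `det t = ϖ^k w`
  have hdet0 : (t : Matrix (Fin 2) (Fin 2) F).det ≠ 0 := (t.isUnit.map Matrix.detMonoidHom).ne_zero
  obtain ⟨k, w, hw, hk⟩ := exists_eq_zpow_mul_of_ne_zero hϖ hdet0
  set cm : Fˣ := (Units.mk0 ϖ h0) ^ (-(k / 2)) with hcm
  set t' : GL (Fin 2) F := cm.map ((Matrix.scalar (Fin 2) : F →+* Matrix (Fin 2) (Fin 2) F) : F →* Matrix (Fin 2) (Fin 2) F) * t with ht'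
  have hcmcoe : ((cm.map ((Matrix.scalar (Fin 2) : F →+* Matrix (Fin 2) (Fin 2) F) : F →* Matrix (Fin 2) (Fin 2) F) : GL (Fin 2) F) : Matrix (Fin 2) (Fin 2) F) =
      ϖ ^ (-(k / 2)) • (1 : Matrix (Fin 2) (Fin 2) F) := by
    rw [Units.coe_map, MonoidHom.coe_coe, Matrix.scalar_apply, ← Matrix.smul_one_eq_diagonal, hcm, Units.val_zpow_eq_zpow_val, Units.val_mk0]
  have ht'act : ∀ x, glVertexAct hϖ t x = glVertexAct hϖ t' x := fun x => (glVertexAct_scalar_mul hϖ cm t x).symm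
  have ht'cen : t' ∈ Subgroup.centralizer ({γτ} : Set (GL (Fin 2) F)) := by
    refine mul_mem ?_ ht
    rw [Subgroup.mem_centralizer_singleton_iff]
    ext : 1
    rw [Units.val_mul, Units.val_mul, hcmcoe, Matrix.smul_mul, Matrix.mul_smul, Matrix.one_mul, Matrix.mul_one]
  have ht'det : valuation F (t' : Matrix (Fin 2) (Fin 2) F).det = valuation F ϖ ^ (k % 2) := by
    rw [ht', Units.val_mul, Matrix.det_mul, hcmcoe, Matrix.det_smul, Matrix.det_one, mul_one, Fintype.card_fin, hk, map_mul, map_mul, map_pow,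
      map_zpow₀, map_zpow₀, hw, mul_one, ← zpow_natCast, ← _root_.zpow_mul, ← zpow_add₀ hv0]
    congr 1
    push_cast
    omega
  rcases Int.emod_two_eq_zero_or_one k with hε | hε
  · -- even: `t'` itself is integral of unit norm
    rw [hε, zpow_zero] at ht'det
    exact ⟨t', key t' ht'cen ht'det, ht'act⟩
  · -- odd: impossible in the inert shape
    rw [hε, zpow_one] at ht'det
    exact absurd ht'det (key' t' ht'cen)

/-! ## §2 The shell is ONE `TK`-orbit; LL's unramified `δ_m` -/

include hϖ in
/-- **THE SHELL IS THE `TK`-ORBIT OF ITS REPRESENTATIVE** in the inert shape: `{x | d x = m} = TK · x_m`, `x_m = r m · v₀` (every vertex is `t · r (d x) · v₀` for a torus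
element `t` — ★ III ∕ IV — and `t` acts like some `t₀ ∈ TK`, §1). [cite: LabesseLanglands1979, §2 p. 8] -/
theorem setOf_shellIndex_eq_eq_orbit_of_inert {u v : F} (hu : u ∈ 𝒪[F]) (hv : v ∈ 𝒪[F])
    (hanis : ∀ c e : F, c ∈ 𝒪[F] → e ∈ 𝒪[F] → valuation F (c ^ 2 + c * e * u - e ^ 2 * v) < 1 → valuation F c < 1 ∧ valuation F e < 1)
    {γτ : GL (Fin 2) F} (hγτ : (γτ : Matrix (Fin 2) (Fin 2) F) = !![0, v; 1, u])
    {r : ℕ → GL (Fin 2) F} (hr : ∀ m, (r m : Matrix (Fin 2) (Fin 2) F) = Matrix.diagonal ![1, ϖ ^ m])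
    (v₀ : {M : Submodule 𝒪[F] (Fin 2 → F) // IsSpecialLattice (RingHom.id F) ϖ !![(0 : F), 1; -1, 0] M})
    {d : {M : Submodule 𝒪[F] (Fin 2 → F) // IsSpecialLattice (RingHom.id F) ϖ !![(0 : F), 1; -1, 0] M} → ℕ}
    (hd : ∀ x, ∃ (t gm : GL (Fin 2) F) (c e : F), (t : Matrix (Fin 2) (Fin 2) F) = !![c, e * v; e, c + e * u] ∧
      (gm : Matrix (Fin 2) (Fin 2) F) = Matrix.diagonal ![1, ϖ ^ d x] ∧ x = glVertexAct hϖ (t * gm) v₀)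
    (hd' : ∀ (x) (t gm : GL (Fin 2) F) (c e : F) (m : ℕ), (t : Matrix (Fin 2) (Fin 2) F) = !![c, e * v; e, c + e * u] →
      (gm : Matrix (Fin 2) (Fin 2) F) = Matrix.diagonal ![1, ϖ ^ m] → x = glVertexAct hϖ (t * gm) v₀ → d x = m) (m : ℕ) :
    {x | d x = m} = {x | ∃ t ∈ Subgroup.centralizer ({γτ} : Set (GL (Fin 2) F)) ⊓ glInt 2 F, glVertexAct hϖ (t * r m) v₀ = x} := by
  ext x
  simp only [Set.mem_setOf_eq]
  constructor
  · intro hx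
    obtain ⟨t, gm, c, e, ht, hgm, hxe⟩ := hd x
    have hgm' : gm = r m := Units.ext (by rw [hgm, hr, hx])
    have htcen : t ∈ Subgroup.centralizer ({γτ} : Set (GL (Fin 2) F)) := (mem_centralizer_companion_iff hγτ t).2 ⟨c, e, ht⟩
    obtain ⟨t₀, ht₀, h⟩ := exists_torusInt_glVertexAct_eq_of_inert hϖ hu hv hanis hγτ htcen
    exact ⟨t₀, ht₀, by rw [glVertexAct_mul, ← h, ← glVertexAct_mul, ← hgm', ← hxe]⟩
  · rintro ⟨t, ht, rfl⟩
    obtain ⟨c, e, htce⟩ := (mem_centralizer_companion_iff hγτ t).1 (Subgroup.mem_inf.1 ht).1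
    exact hd' _ t (r m) c e m htce (hr m) rfl

include hϖ in
/-- **THE SHELL COUNT IN THE INERT SHAPE**: `#{x | d x = m} = [TK : TK(m)]` whenever the index is non-zero (then the shell is finite) — ONE orbit (§2) and ★ V-a
`ncard_torusInt_orbit_eq_relIndex`. [cite: LabesseLanglands1979, §2 p. 8] -/
theorem ncard_setOf_shellIndex_eq_relIndex_of_inert {u v : F} (hu : u ∈ 𝒪[F]) (hv : v ∈ 𝒪[F])
    (hanis : ∀ c e : F, c ∈ 𝒪[F] → e ∈ 𝒪[F] → valuation F (c ^ 2 + c * e * u - e ^ 2 * v) < 1 → valuation F c < 1 ∧ valuation F e < 1)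
    {γτ : GL (Fin 2) F} (hγτ : (γτ : Matrix (Fin 2) (Fin 2) F) = !![0, v; 1, u])
    {r : ℕ → GL (Fin 2) F} (hr : ∀ m, (r m : Matrix (Fin 2) (Fin 2) F) = Matrix.diagonal ![1, ϖ ^ m])
    (v₀ : {M : Submodule 𝒪[F] (Fin 2 → F) // IsSpecialLattice (RingHom.id F) ϖ !![(0 : F), 1; -1, 0] M})
    (hv₀ : v₀.1 = latt (1 : Matrix (Fin 2) (Fin 2) F))
    {d : {M : Submodule 𝒪[F] (Fin 2 → F) // IsSpecialLattice (RingHom.id F) ϖ !![(0 : F), 1; -1, 0] M} → ℕ}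
    (hd : ∀ x, ∃ (t gm : GL (Fin 2) F) (c e : F), (t : Matrix (Fin 2) (Fin 2) F) = !![c, e * v; e, c + e * u] ∧
      (gm : Matrix (Fin 2) (Fin 2) F) = Matrix.diagonal ![1, ϖ ^ d x] ∧ x = glVertexAct hϖ (t * gm) v₀)
    (hd' : ∀ (x) (t gm : GL (Fin 2) F) (c e : F) (m : ℕ), (t : Matrix (Fin 2) (Fin 2) F) = !![c, e * v; e, c + e * u] →
      (gm : Matrix (Fin 2) (Fin 2) F) = Matrix.diagonal ![1, ϖ ^ m] → x = glVertexAct hϖ (t * gm) v₀ → d x = m) (m : ℕ)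
    (hidx : (Subgroup.centralizer ({γτ} : Set (GL (Fin 2) F)) ⊓ glInt 2 F ⊓ (glInt 2 F).map (MulAut.conj (r m)).toMonoidHom).relIndex
      (Subgroup.centralizer ({γτ} : Set (GL (Fin 2) F)) ⊓ glInt 2 F) ≠ 0) :
    {x | d x = m}.Finite ∧ {x | d x = m}.ncard =
      (Subgroup.centralizer ({γτ} : Set (GL (Fin 2) F)) ⊓ glInt 2 F ⊓ (glInt 2 F).map (MulAut.conj (r m)).toMonoidHom).relIndex
        (Subgroup.centralizer ({γτ} : Set (GL (Fin 2) F)) ⊓ glInt 2 F) := by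
  have hS := ncard_torusInt_orbit_eq_relIndex hϖ (r m) v₀ hv₀ (γτ := γτ)
  rw [setOf_shellIndex_eq_eq_orbit_of_inert hϖ hu hv hanis hγτ hr v₀ hd hd' m]
  exact ⟨Set.finite_of_ncard_ne_zero (by rw [hS]; exact hidx), hS⟩

include hϖ in
/-- **LABESSE–LANGLANDS' UNRAMIFIED `δ_m`**: in the inert shape over a DVR with finite residue field of cardinality `q`, the shell `{x | d x = m}` of the tree of `SL₂(F)` about
the vertex fixed by the torus `F[τ]^×` is FINITE and has EXACTLY **`(q + 1)·q^{m−1}`** vertices for `m ≥ 1` and `1` for `m = 0` (★ V-INDEX-unr × §2) — the sphere of radius `m` of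
the `(q+1)`-regular tree. [cite: LabesseLanglands1979, §2 p. 8] [cite: Serre1980Trees, Ch. II §1.1] -/
theorem ncard_setOf_shellIndex_eq_of_inert [Finite (IsLocalRing.ResidueField 𝒪[F])] {u v : F} (hu : u ∈ 𝒪[F]) (hv : v ∈ 𝒪[F])
    (hanis : ∀ c e : F, c ∈ 𝒪[F] → e ∈ 𝒪[F] → valuation F (c ^ 2 + c * e * u - e ^ 2 * v) < 1 → valuation F c < 1 ∧ valuation F e < 1)
    {γτ : GL (Fin 2) F} (hγτ : (γτ : Matrix (Fin 2) (Fin 2) F) = !![0, v; 1, u])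
    {r : ℕ → GL (Fin 2) F} (hr : ∀ m, (r m : Matrix (Fin 2) (Fin 2) F) = Matrix.diagonal ![1, ϖ ^ m])
    (v₀ : {M : Submodule 𝒪[F] (Fin 2 → F) // IsSpecialLattice (RingHom.id F) ϖ !![(0 : F), 1; -1, 0] M})
    (hv₀ : v₀.1 = latt (1 : Matrix (Fin 2) (Fin 2) F))
    {d : {M : Submodule 𝒪[F] (Fin 2 → F) // IsSpecialLattice (RingHom.id F) ϖ !![(0 : F), 1; -1, 0] M} → ℕ}
    (hd : ∀ x, ∃ (t gm : GL (Fin 2) F) (c e : F), (t : Matrix (Fin 2) (Fin 2) F) = !![c, e * v; e, c + e * u] ∧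
      (gm : Matrix (Fin 2) (Fin 2) F) = Matrix.diagonal ![1, ϖ ^ d x] ∧ x = glVertexAct hϖ (t * gm) v₀)
    (hd' : ∀ (x) (t gm : GL (Fin 2) F) (c e : F) (m : ℕ), (t : Matrix (Fin 2) (Fin 2) F) = !![c, e * v; e, c + e * u] →
      (gm : Matrix (Fin 2) (Fin 2) F) = Matrix.diagonal ![1, ϖ ^ m] → x = glVertexAct hϖ (t * gm) v₀ → d x = m) (m : ℕ) :
    {x | d x = m}.Finite ∧ {x | d x = m}.ncard =
      if m = 0 then 1 else (Nat.card (IsLocalRing.ResidueField 𝒪[F]) + 1) * Nat.card (IsLocalRing.ResidueField 𝒪[F]) ^ (m - 1) := by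
  have hq : ∀ i, Nat.card (IsLocalRing.ResidueField 𝒪[F]) ^ i ≠ 0 := fun i => pow_ne_zero i Nat.card_pos.ne'
  have hidx : ((Subgroup.centralizer ({γτ} : Set (GL (Fin 2) F)) ⊓ glInt 2 F) ⊓ (glInt 2 F).map (MulAut.conj (r m)).toMonoidHom).relIndex
      (Subgroup.centralizer ({γτ} : Set (GL (Fin 2) F)) ⊓ glInt 2 F) =
      if m = 0 then 1 else (Nat.card (IsLocalRing.ResidueField 𝒪[F]) + 1) * Nat.card (IsLocalRing.ResidueField 𝒪[F]) ^ (m - 1) := by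
    split_ifs with hm
    · subst hm; exact relIndex_torusInt_shellStab_zero (hr 0)
    · exact relIndex_torusInt_shellStab_eq_of_inert hϖ hu hv hanis hγτ (hr m) (Nat.one_le_iff_ne_zero.2 hm)
  have hne : ((Subgroup.centralizer ({γτ} : Set (GL (Fin 2) F)) ⊓ glInt 2 F) ⊓ (glInt 2 F).map (MulAut.conj (r m)).toMonoidHom).relIndex
      (Subgroup.centralizer ({γτ} : Set (GL (Fin 2) F)) ⊓ glInt 2 F) ≠ 0 := by
    rw [hidx]; split_ifs
    · exact one_ne_zero
    · exact mul_ne_zero (Nat.succ_ne_zero _) (hq _)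
  have h := ncard_setOf_shellIndex_eq_relIndex_of_inert hϖ hu hv hanis hγτ hr v₀ hv₀ hd hd' m hne
  rw [hidx] at h
  exact h

/-! ## §3 The fixed shells of a unit of the inert order -/

include hϖ in
/-- **THE SHELL-SUM COEFFICIENTS AND `hfin`, INERT SHAPE** (the (W′1)-side inputs of ★ B-p14 (g33) `FixedPointsShellValueLaw` for an UNRAMIFIED torus): for a unit
`γ = (a, bv; b, a+bu)` of the order (`a b ∈ 𝒪`, `|det γ| = 1`) with `|b| = |ϖ|ⁿ`, the fixed set `{x | γ · x = x}` is FINITE and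
**`#{x | γ · x = x ∧ d x = i} = if i ≤ n then δ_i else 0`**, `δ_0 = 1`, `δ_i = (q+1)q^{i−1}`. [cite: LabesseLanglands1979, §2 p. 8] [cite: Kottwitz1988, §2] -/
theorem ncard_setOf_glVertexAct_torus_eq_self_sep_shellIndex_of_inert [Finite (IsLocalRing.ResidueField 𝒪[F])] {u v a b : F} (hu : u ∈ 𝒪[F]) (hv : v ∈ 𝒪[F])
    (hanis : ∀ c e : F, c ∈ 𝒪[F] → e ∈ 𝒪[F] → valuation F (c ^ 2 + c * e * u - e ^ 2 * v) < 1 → valuation F c < 1 ∧ valuation F e < 1)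
    (ha : a ∈ 𝒪[F]) (hb : b ∈ 𝒪[F]) {n : ℕ} (hbn : valuation F b = valuation F ϖ ^ n)
    {γ : GL (Fin 2) F} (hγ : (γ : Matrix (Fin 2) (Fin 2) F) = !![a, b * v; b, a + b * u]) (hγdet : valuation F (γ : Matrix (Fin 2) (Fin 2) F).det = 1)
    {γτ : GL (Fin 2) F} (hγτ : (γτ : Matrix (Fin 2) (Fin 2) F) = !![0, v; 1, u])
    {r : ℕ → GL (Fin 2) F} (hr : ∀ m, (r m : Matrix (Fin 2) (Fin 2) F) = Matrix.diagonal ![1, ϖ ^ m])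
    (v₀ : {M : Submodule 𝒪[F] (Fin 2 → F) // IsSpecialLattice (RingHom.id F) ϖ !![(0 : F), 1; -1, 0] M})
    (hv₀ : v₀.1 = latt (1 : Matrix (Fin 2) (Fin 2) F))
    {d : {M : Submodule 𝒪[F] (Fin 2 → F) // IsSpecialLattice (RingHom.id F) ϖ !![(0 : F), 1; -1, 0] M} → ℕ}
    (hd : ∀ x, ∃ (t gm : GL (Fin 2) F) (c e : F), (t : Matrix (Fin 2) (Fin 2) F) = !![c, e * v; e, c + e * u] ∧
      (gm : Matrix (Fin 2) (Fin 2) F) = Matrix.diagonal ![1, ϖ ^ d x] ∧ x = glVertexAct hϖ (t * gm) v₀)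
    (hd' : ∀ (x) (t gm : GL (Fin 2) F) (c e : F) (m : ℕ), (t : Matrix (Fin 2) (Fin 2) F) = !![c, e * v; e, c + e * u] →
      (gm : Matrix (Fin 2) (Fin 2) F) = Matrix.diagonal ![1, ϖ ^ m] → x = glVertexAct hϖ (t * gm) v₀ → d x = m) :
    {x | glVertexAct hϖ γ x = x}.Finite ∧
      ∀ i, {x | glVertexAct hϖ γ x = x ∧ d x = i}.ncard =
        if i ≤ n then (if i = 0 then 1 else (Nat.card (IsLocalRing.ResidueField 𝒪[F]) + 1) * Nat.card (IsLocalRing.ResidueField 𝒪[F]) ^ (i - 1)) else 0 := by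
  refine ⟨?_, fun i => ?_⟩
  · -- `Fix(γ) = ⋃_{i ≤ n} shell i`, each finite
    have hsub : {x | glVertexAct hϖ γ x = x} ⊆ ⋃ i ∈ Finset.range (n + 1), {x | d x = i} := by
      intro x hx
      have hle := shellIndex_le_of_glVertexAct_torus_eq_self hϖ hu hv ha hb hbn hγ hγdet v₀ hv₀ hd x hx
      simp only [Set.mem_iUnion, Finset.mem_range, Set.mem_setOf_eq]
      exact ⟨d x, Nat.lt_succ_of_le hle, rfl⟩
    refine Set.Finite.subset (Set.Finite.biUnion (Finset.finite_toSet _) fun i _ => ?_) hsub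
    exact (ncard_setOf_shellIndex_eq_of_inert hϖ hu hv hanis hγτ hr v₀ hv₀ hd hd' i).1
  · rw [setOf_glVertexAct_torus_eq_self_sep_shellIndex_eq hϖ hu hv ha hb hbn hγ hγdet v₀ hv₀ hd i]
    by_cases hi : i ≤ n
    · rw [if_pos hi, if_pos hi]
      exact (ncard_setOf_shellIndex_eq_of_inert hϖ hu hv hanis hγτ hr v₀ hv₀ hd hd' i).2
    · rw [if_neg hi, if_neg hi]
      exact Set.ncard_empty _

/-! ## §4 The vertex ball `{x | d x ≤ n}`: `(q − 1)·#B(n) + 2 = (q + 1)·qⁿ` -/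

include hϖ in
/-- **`Fix(γ) = {x | d x ≤ n}`** for a unit `γ = (a, bv; b, a+bu)` with `|b| = |ϖ|ⁿ` (★ IV `glVertexAct_torus_eq_self_iff_shellIndex_le`, as a set identity).
[cite: LabesseLanglands1979, §2 p. 8] [cite: Serre1980Trees, Ch. II §1.3] -/
theorem setOf_glVertexAct_torus_eq_self_eq_setOf_shellIndex_le {u v a b : F} (hu : u ∈ 𝒪[F]) (hv : v ∈ 𝒪[F]) (ha : a ∈ 𝒪[F]) (hb : b ∈ 𝒪[F]) {n : ℕ}
    (hbn : valuation F b = valuation F ϖ ^ n)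
    {γ : GL (Fin 2) F} (hγ : (γ : Matrix (Fin 2) (Fin 2) F) = !![a, b * v; b, a + b * u]) (hγdet : valuation F (γ : Matrix (Fin 2) (Fin 2) F).det = 1)
    (v₀ : {M : Submodule 𝒪[F] (Fin 2 → F) // IsSpecialLattice (RingHom.id F) ϖ !![(0 : F), 1; -1, 0] M})
    (hv₀ : v₀.1 = latt (1 : Matrix (Fin 2) (Fin 2) F))
    {d : {M : Submodule 𝒪[F] (Fin 2 → F) // IsSpecialLattice (RingHom.id F) ϖ !![(0 : F), 1; -1, 0] M} → ℕ}
    (hd : ∀ x, ∃ (t gm : GL (Fin 2) F) (c e : F), (t : Matrix (Fin 2) (Fin 2) F) = !![c, e * v; e, c + e * u] ∧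
      (gm : Matrix (Fin 2) (Fin 2) F) = Matrix.diagonal ![1, ϖ ^ d x] ∧ x = glVertexAct hϖ (t * gm) v₀) :
    {x | glVertexAct hϖ γ x = x} = {x | d x ≤ n} := by
  ext x
  exact glVertexAct_torus_eq_self_iff_shellIndex_le hϖ hu hv ha hb hbn hγ hγdet v₀ hv₀ hd x

include hϖ in
/-- **THE BALL RECURSION** `#{x | d x ≤ n+1} = #{x | d x ≤ n} + (q+1)·qⁿ` (and all these balls are finite): the ball of radius `n + 1` is the disjoint union of the ball of radius
`n` and the shell `n + 1` (§2). [cite: Serre1980Trees, Ch. II §1.1] [cite: LabesseLanglands1979, §2 p. 8] -/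
theorem ncard_setOf_shellIndex_le_succ_of_inert [Finite (IsLocalRing.ResidueField 𝒪[F])] {u v : F} (hu : u ∈ 𝒪[F]) (hv : v ∈ 𝒪[F])
    (hanis : ∀ c e : F, c ∈ 𝒪[F] → e ∈ 𝒪[F] → valuation F (c ^ 2 + c * e * u - e ^ 2 * v) < 1 → valuation F c < 1 ∧ valuation F e < 1)
    {γτ : GL (Fin 2) F} (hγτ : (γτ : Matrix (Fin 2) (Fin 2) F) = !![0, v; 1, u])
    {r : ℕ → GL (Fin 2) F} (hr : ∀ m, (r m : Matrix (Fin 2) (Fin 2) F) = Matrix.diagonal ![1, ϖ ^ m])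
    (v₀ : {M : Submodule 𝒪[F] (Fin 2 → F) // IsSpecialLattice (RingHom.id F) ϖ !![(0 : F), 1; -1, 0] M})
    (hv₀ : v₀.1 = latt (1 : Matrix (Fin 2) (Fin 2) F))
    {d : {M : Submodule 𝒪[F] (Fin 2 → F) // IsSpecialLattice (RingHom.id F) ϖ !![(0 : F), 1; -1, 0] M} → ℕ}
    (hd : ∀ x, ∃ (t gm : GL (Fin 2) F) (c e : F), (t : Matrix (Fin 2) (Fin 2) F) = !![c, e * v; e, c + e * u] ∧
      (gm : Matrix (Fin 2) (Fin 2) F) = Matrix.diagonal ![1, ϖ ^ d x] ∧ x = glVertexAct hϖ (t * gm) v₀)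
    (hd' : ∀ (x) (t gm : GL (Fin 2) F) (c e : F) (m : ℕ), (t : Matrix (Fin 2) (Fin 2) F) = !![c, e * v; e, c + e * u] →
      (gm : Matrix (Fin 2) (Fin 2) F) = Matrix.diagonal ![1, ϖ ^ m] → x = glVertexAct hϖ (t * gm) v₀ → d x = m) (n : ℕ) :
    {x | d x ≤ n}.Finite ∧ {x | d x ≤ n + 1}.ncard = {x | d x ≤ n}.ncard + (Nat.card (IsLocalRing.ResidueField 𝒪[F]) + 1) * Nat.card (IsLocalRing.ResidueField 𝒪[F]) ^ n := by
  have hfin : ∀ k, {x | d x ≤ k}.Finite := by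
    intro k
    have heq : {x | d x ≤ k} = ⋃ i ∈ Finset.range (k + 1), {x | d x = i} := by
      ext x
      simp only [Set.mem_setOf_eq, Set.mem_iUnion, Finset.mem_range, exists_prop]
      exact ⟨fun h => ⟨d x, Nat.lt_succ_of_le h, rfl⟩, fun ⟨i, hi, hx⟩ => hx ▸ Nat.le_of_lt_succ hi⟩
    rw [heq]
    exact Set.Finite.biUnion (Finset.finite_toSet _) fun i _ => (ncard_setOf_shellIndex_eq_of_inert hϖ hu hv hanis hγτ hr v₀ hv₀ hd hd' i).1
  refine ⟨hfin n, ?_⟩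
  have hunion : {x | d x ≤ n + 1} = {x | d x ≤ n} ∪ {x | d x = n + 1} := by
    ext x
    simp only [Set.mem_setOf_eq, Set.mem_union]
    omega
  have hdisj : Disjoint {x | d x ≤ n} {x | d x = n + 1} := by
    rw [Set.disjoint_left]
    intro x hx hx'
    simp only [Set.mem_setOf_eq] at hx hx'
    omega
  have hshell := ncard_setOf_shellIndex_eq_of_inert hϖ hu hv hanis hγτ hr v₀ hv₀ hd hd' (n + 1)
  rw [hunion, Set.ncard_union_eq hdisj (hfin n) hshell.1, hshell.2, if_neg (Nat.succ_ne_zero n), Nat.add_sub_cancel]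

include hϖ in
/-- **THE VERTEX BALL OF THE `(q+1)`-REGULAR TREE**: in the inert shape, `(q − 1)·#{x | d x ≤ n} + 2 = (q + 1)·qⁿ`, i.e. `#B(n) = 1 + (q+1)(qⁿ − 1)∕(q − 1) = 1 + (q+1) + (q+1)q + ⋯ +
(q+1)q^{n−1}` (induction on `n` with §4's recursion; `#B(0) = #{x | d x = 0} = 1`). [cite: Serre1980Trees, Ch. II §1.1] [cite: LabesseLanglands1979, §2 p. 8] -/
theorem ncard_setOf_shellIndex_le_of_inert [Finite (IsLocalRing.ResidueField 𝒪[F])] {u v : F} (hu : u ∈ 𝒪[F]) (hv : v ∈ 𝒪[F])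
    (hanis : ∀ c e : F, c ∈ 𝒪[F] → e ∈ 𝒪[F] → valuation F (c ^ 2 + c * e * u - e ^ 2 * v) < 1 → valuation F c < 1 ∧ valuation F e < 1)
    {γτ : GL (Fin 2) F} (hγτ : (γτ : Matrix (Fin 2) (Fin 2) F) = !![0, v; 1, u])
    {r : ℕ → GL (Fin 2) F} (hr : ∀ m, (r m : Matrix (Fin 2) (Fin 2) F) = Matrix.diagonal ![1, ϖ ^ m])
    (v₀ : {M : Submodule 𝒪[F] (Fin 2 → F) // IsSpecialLattice (RingHom.id F) ϖ !![(0 : F), 1; -1, 0] M})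
    (hv₀ : v₀.1 = latt (1 : Matrix (Fin 2) (Fin 2) F))
    {d : {M : Submodule 𝒪[F] (Fin 2 → F) // IsSpecialLattice (RingHom.id F) ϖ !![(0 : F), 1; -1, 0] M} → ℕ}
    (hd : ∀ x, ∃ (t gm : GL (Fin 2) F) (c e : F), (t : Matrix (Fin 2) (Fin 2) F) = !![c, e * v; e, c + e * u] ∧
      (gm : Matrix (Fin 2) (Fin 2) F) = Matrix.diagonal ![1, ϖ ^ d x] ∧ x = glVertexAct hϖ (t * gm) v₀)
    (hd' : ∀ (x) (t gm : GL (Fin 2) F) (c e : F) (m : ℕ), (t : Matrix (Fin 2) (Fin 2) F) = !![c, e * v; e, c + e * u] →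
      (gm : Matrix (Fin 2) (Fin 2) F) = Matrix.diagonal ![1, ϖ ^ m] → x = glVertexAct hϖ (t * gm) v₀ → d x = m) (n : ℕ) :
    (Nat.card (IsLocalRing.ResidueField 𝒪[F]) - 1) * {x | d x ≤ n}.ncard + 2 = (Nat.card (IsLocalRing.ResidueField 𝒪[F]) + 1) * Nat.card (IsLocalRing.ResidueField 𝒪[F]) ^ n := by
  obtain ⟨k, hk⟩ : ∃ k, Nat.card (IsLocalRing.ResidueField 𝒪[F]) = k + 1 := ⟨_, (Nat.succ_pred_eq_of_pos Nat.card_pos).symm⟩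
  rw [hk, Nat.add_sub_cancel]
  induction n with
  | zero =>
    have h0 : {x | d x ≤ 0} = {x | d x = 0} := by ext x; simp only [Set.mem_setOf_eq, Nat.le_zero]
    rw [h0, (ncard_setOf_shellIndex_eq_of_inert hϖ hu hv hanis hγτ hr v₀ hv₀ hd hd' 0).2, if_pos rfl]
    ring
  | succ n ih =>
    have hrec := (ncard_setOf_shellIndex_le_succ_of_inert hϖ hu hv hanis hγτ hr v₀ hv₀ hd hd' n).2
    rw [hk] at hrec
    rw [hrec, mul_add, add_right_comm, ih]
    ring

include hϖ in
/-- **THE NUMBER OF VERTICES FIXED BY A UNIT OF THE INERT ORDER**: for `γ = (a, bv; b, a+bu)` (`a b ∈ 𝒪`, `|det γ| = 1`, `|b| = |ϖ|ⁿ`), `(q − 1)·#{x | γ·x = x} + 2 = (q + 1)·qⁿ` —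
`γ` fixes exactly the ball of radius `n = ord b` about the vertex fixed by the whole torus, `1 + (q+1)(qⁿ−1)∕(q−1)` vertices (`n = 0, 1, 2`: `1`, `q + 2`, `q² + q + 2`).
[cite: LabesseLanglands1979, §2 p. 8] [cite: Serre1980Trees, Ch. II §1.1] [cite: Kottwitz1988, §2] -/
theorem ncard_setOf_glVertexAct_torus_eq_self_of_inert [Finite (IsLocalRing.ResidueField 𝒪[F])] {u v a b : F} (hu : u ∈ 𝒪[F]) (hv : v ∈ 𝒪[F])
    (hanis : ∀ c e : F, c ∈ 𝒪[F] → e ∈ 𝒪[F] → valuation F (c ^ 2 + c * e * u - e ^ 2 * v) < 1 → valuation F c < 1 ∧ valuation F e < 1)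
    (ha : a ∈ 𝒪[F]) (hb : b ∈ 𝒪[F]) {n : ℕ} (hbn : valuation F b = valuation F ϖ ^ n)
    {γ : GL (Fin 2) F} (hγ : (γ : Matrix (Fin 2) (Fin 2) F) = !![a, b * v; b, a + b * u]) (hγdet : valuation F (γ : Matrix (Fin 2) (Fin 2) F).det = 1)
    {γτ : GL (Fin 2) F} (hγτ : (γτ : Matrix (Fin 2) (Fin 2) F) = !![0, v; 1, u])
    {r : ℕ → GL (Fin 2) F} (hr : ∀ m, (r m : Matrix (Fin 2) (Fin 2) F) = Matrix.diagonal ![1, ϖ ^ m])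
    (v₀ : {M : Submodule 𝒪[F] (Fin 2 → F) // IsSpecialLattice (RingHom.id F) ϖ !![(0 : F), 1; -1, 0] M})
    (hv₀ : v₀.1 = latt (1 : Matrix (Fin 2) (Fin 2) F))
    {d : {M : Submodule 𝒪[F] (Fin 2 → F) // IsSpecialLattice (RingHom.id F) ϖ !![(0 : F), 1; -1, 0] M} → ℕ}
    (hd : ∀ x, ∃ (t gm : GL (Fin 2) F) (c e : F), (t : Matrix (Fin 2) (Fin 2) F) = !![c, e * v; e, c + e * u] ∧
      (gm : Matrix (Fin 2) (Fin 2) F) = Matrix.diagonal ![1, ϖ ^ d x] ∧ x = glVertexAct hϖ (t * gm) v₀)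
    (hd' : ∀ (x) (t gm : GL (Fin 2) F) (c e : F) (m : ℕ), (t : Matrix (Fin 2) (Fin 2) F) = !![c, e * v; e, c + e * u] →
      (gm : Matrix (Fin 2) (Fin 2) F) = Matrix.diagonal ![1, ϖ ^ m] → x = glVertexAct hϖ (t * gm) v₀ → d x = m) :
    (Nat.card (IsLocalRing.ResidueField 𝒪[F]) - 1) * {x | glVertexAct hϖ γ x = x}.ncard + 2 =
      (Nat.card (IsLocalRing.ResidueField 𝒪[F]) + 1) * Nat.card (IsLocalRing.ResidueField 𝒪[F]) ^ n := by
  rw [setOf_glVertexAct_torus_eq_self_eq_setOf_shellIndex_le hϖ hu hv ha hb hbn hγ hγdet v₀ hv₀ hd]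
  exact ncard_setOf_shellIndex_le_of_inert hϖ hu hv hanis hγτ hr v₀ hv₀ hd hd' n

end Literature.NumberTheory.Automorphic.HermitianLatticeTree

end
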